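import Literature.RepresentationTheory.SubrepresentationResScalars
import Literature.RepresentationTheory.SubrepresentationMapEquiv
import HarnessLib

/-!
# Restriction of scalars along `R → k`: identifications of modules over the group ring `R[G]`

Topic `RepresentationTheory`; namespace `Literature.RepresentationTheory`.  Plumbing DEFINITIONS + API (reviewed
kind); no named fact, no instance, no notation, no `sorry`.  Sequel of `SubrepresentationResScalars`
(setting of [SerreLinearRepresentations1977, §15.1–15.2], [EmertonGeeSavitt2015, §4.1]: `k`-representations
regarded over `R` through `R → k`, as modules over the group ring via Mathlib's `Representation.asModule`):

* **`Representation.Equiv.asModuleResEquiv R e`** — an equivalence `e : ρ ≃ σ` of `k`-representations is an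
  `R[G]`-linear isomorphism `(ρ|_R).asModule ≃ (σ|_R).asModule`;
* `subrepInclRes` — the inclusion of a subrepresentation, restricted to `R`, as an intertwining map;
* **`subrepAsModuleResEquiv σ hsurj Y`** — for `R → k` onto and a `k`-subrepresentation `Y ⊆ σ`, the identity
  `(Y|_R).asModule ≃ₗ[R[G]] ↥(R[G]-submodule of (σ|_R).asModule attached to Y)`, with its value lemma.
-/

noncomputable section

namespace Literature.RepresentationTheory

open Function
open Literature.NumberTheory.Automorphic (TwistedQuotient.resScalars TwistedQuotient.resScalars_apply)

universe u

variable {R k : Type u} [CommRing R] [CommRing k] [Algebra R k] {G : Type u} [Group G]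
  {V : Type u} [AddCommGroup V] [Module k V] [Module R V] [IsScalarTower R k V]
  {W : Type u} [AddCommGroup W] [Module k W] [Module R W] [IsScalarTower R k W]
  {ρ : Representation k G V} {σ : Representation k G W}

variable (R) in
/-- **An equivalence of `k`-representations is a linear equivalence over the group ring `R[G]`** of the
restrictions of scalars (`R → k` any algebra). [cite: SerreLinearRepresentations1977, §15.2] -/
def _root_.Representation.Equiv.asModuleResEquiv (e : ρ.Equiv σ) :
    (TwistedQuotient.resScalars R ρ).asModule ≃ₗ[MonoidAlgebra R G] (TwistedQuotient.resScalars R σ).asModule :=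
  { Representation.IntertwiningMap.equivLinearMapAsModule _ _ (e.toIntertwiningMap.resScalarsMap R) with
    invFun := Representation.IntertwiningMap.equivLinearMapAsModule _ _ (e.symm.toIntertwiningMap.resScalarsMap R)
    left_inv := fun v => e.symm_apply_apply v
    right_inv := fun w => e.apply_symm_apply w }

/-- Unfolding lemma `asModuleResEquiv_apply`. [cite: SerreLinearRepresentations1977, §15.2] -/
@[simp]
theorem _root_.Representation.Equiv.asModuleResEquiv_apply (e : ρ.Equiv σ) (v : (TwistedQuotient.resScalars R ρ).asModule) :
    e.asModuleResEquiv R v = (TwistedQuotient.resScalars R σ).asModuleEquiv.symm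
      (e ((TwistedQuotient.resScalars R ρ).asModuleEquiv v)) := rfl

variable (σ) in
/-- The inclusion of a subrepresentation, restricted to `R`, as an intertwining map. [cite: SerreLinearRepresentations1977, §15.2] -/
def subrepInclRes (Y : Subrepresentation σ) :
    (TwistedQuotient.resScalars R Y.toRepresentation).IntertwiningMap (TwistedQuotient.resScalars R σ) where
  toLinearMap := Y.toSubmodule.subtype.restrictScalars R
  isIntertwining' g := by
    refine LinearMap.ext fun y => ?_
    rfl

/-- Unfolding lemma `subrepInclRes_apply`. [cite: SerreLinearRepresentations1977, §15.2] -/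
@[simp]
theorem subrepInclRes_apply (Y : Subrepresentation σ) (y : Y.toSubmodule) :
    subrepInclRes (R := R) σ Y y = (y : W) := rfl

variable (σ) in
/-- **A `k`-subrepresentation, restricted to `R`, as a module over the group ring `R[G]`**: the identity map
`(Y|_R).asModule ≃ ↥(R[G]-submodule attached to Y)` is an `R[G]`-linear isomorphism (`R → k` onto). [cite: SerreLinearRepresentations1977, §15.2] -/
def subrepAsModuleResEquiv (hsurj : Surjective (algebraMap R k)) (Y : Subrepresentation σ) :
    (TwistedQuotient.resScalars R Y.toRepresentation).asModule ≃ₗ[MonoidAlgebra R G]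
      ↥(Subrepresentation.asSubmodule ((subrepResScalarsOrderIso σ hsurj).symm Y)) :=
  LinearEquiv.ofBijective
    ((Representation.IntertwiningMap.equivLinearMapAsModule _ _ (subrepInclRes (R := R) σ Y)).codRestrict
      (Subrepresentation.asSubmodule ((subrepResScalarsOrderIso σ hsurj).symm Y))
      fun y => ((TwistedQuotient.resScalars R Y.toRepresentation).asModuleEquiv y).2)
    ⟨fun y y' h => by
      apply (TwistedQuotient.resScalars R Y.toRepresentation).asModuleEquiv.injective
      exact Subtype.ext (congrArg (fun z => ((z : ↥(Subrepresentation.asSubmodule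
        ((subrepResScalarsOrderIso σ hsurj).symm Y))) : (TwistedQuotient.resScalars R σ).asModule)) h),
     fun w => ⟨(TwistedQuotient.resScalars R Y.toRepresentation).asModuleEquiv.symm
        ⟨(TwistedQuotient.resScalars R σ).asModuleEquiv (w : (TwistedQuotient.resScalars R σ).asModule), w.2⟩,
        rfl⟩⟩

/-- Unfolding lemma `coe_subrepAsModuleResEquiv_apply`. [cite: SerreLinearRepresentations1977, §15.2] -/
@[simp]
theorem coe_subrepAsModuleResEquiv_apply (hsurj : Surjective (algebraMap R k)) (Y : Subrepresentation σ)
    (y : (TwistedQuotient.resScalars R Y.toRepresentation).asModule) :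
    ((subrepAsModuleResEquiv σ hsurj Y y :
        ↥(Subrepresentation.asSubmodule ((subrepResScalarsOrderIso σ hsurj).symm Y))) :
        (TwistedQuotient.resScalars R σ).asModule) =
      (TwistedQuotient.resScalars R σ).asModuleEquiv.symm
        (((TwistedQuotient.resScalars R Y.toRepresentation).asModuleEquiv y : Y.toSubmodule) : W) := rfl

end Literature.RepresentationTheory
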